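import Literature.MathematicalPhysics.QuantumFieldTheory.Balaban1983to89.B3Cor23ConcreteProof

/-!
# `Balaban1983to89.B3Cor23ConcreteTwoDim` — T. Bałaban, *(Higgs)₂,₃ quantum fields in a finite volume. III. Renormalization*,
Commun. Math. Phys. **88** (1983) 411–445 [Balaban1983Higgs3]: **Corollary 2.3** (p. 429) in **d = 2** — *"In d = 2 graphs are
more convergent, so degrees are still positive"* — on the concrete family of graphs `B3Cor23Concrete.family 2 n̄`

statement-level skeleton of published theorems with citation tags; proofs where landed; nothing here is a claim about the Yang–Mills mass gap

PDF held: `paper:balaban1983-higgs-2-3-quantum-fields-finite-volume` (journal page = PDF page + 410); renders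
`…/b2b-balaban-ref1/pages/1983-cmp88-higgs23-III/1983-cmp88-higgs23-III-p012, p013, p018, p019-x4.png` (pp. 422, 423, 428, 429).
CITATION HEADER (lean-in-tree rule).  lit-balaban TYPED SKELETON (HOME `run/shared/lean/pub/lit-balaban/`), Phase 2, seat p18, unit
`lit-balaban-p18`: SKELETON row **B3.Cor2.3** (decl of record `B3Sect2Statements.Cor23`, kind «model-instance»), the d = 2 half
of the printed sentence p. 429; model and d = 3 in `…B3Cor23Concrete` / `…B3Cor23ConcreteProof`.
WHAT THIS MODULE PROVES (sorry-free; no `Prop` fact introduced; axioms standard).  In d = 2 a leg has dimension −(d−2)/2 = 0, so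
(2.1) reads D_G(v) = (#η) − (#internal differentiations) + [#internal A′-legs at (1.14)–(1.15)]; every admissible vertex has
D_G(v) ≥ 1 (`Facts.one_le_degreeIn`, using that a differentiation acting on an internal line acts on an internal φ′-leg,
`intDiffs_le_intScalar`).  Proved for every graph of the model: `deg_pos_of_hasVertex1315`, `deg_pos_of_hasRVertex` (n̄ ≥ 3),
`deg_pos_of_four_lt_numExtLegs` ((2.17) gives only D ≥ V − 2 in d = 2; the one- and two-vertex graphs are done by hand),
`deg_pos_of_hasFiniteCounterterm` (repaired third clause: ≥ 2 external legs), `cor23_corrected`, and **Cor. 2.3 verbatim** on the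
graphs with ≥ 2 external legs: `cor23_twoExtLegs : 3 ≤ n̄ → Cor23 (familyTwoExtLegs 2 n̄)`.  As printed the corollary fails in
d = 2 as well (`B3Cor23ConcreteProof.not_cor23 2`: the (1.7)-tadpole has D = 0); HOME/GAPS.md G-B3-01.
-/

namespace Literature.MathematicalPhysics.QuantumFieldTheory.Balaban1983to89.B3Cor23ConcreteTwoDim

open Finset B3Prop1 B3Sect2Statements B3VertexBridge B3Cor23Concrete B3Cor23ConcreteProof

/-! ## Per-vertex facts, d = 2 (legs have dimension −(d−2)/2 = 0) -/

namespace Facts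

/-- d = 2: every admissible catalogue vertex has D_G(v) ≥ 1 in every graph; ≥ 2 if it has at least three external legs and is
not of the form (1.13)–(1.15); ≥ 3 if it has at least five. (In d = 2 a leg has dimension 0, so D_G(v) = (#η) − (#internal
differentiations) + [internal A′-legs at (1.14)–(1.15)].) [cite: Balaban1983Higgs3, (2.1) p.422] -/
theorem one_le_degreeIn {nbar : ℕ} (v : VertexKind) (hv : v.Admissible nbar) (inc : Incidence (toCounts 2 v))
    (hδs : inc.intDiffs ≤ inc.intScalar) : 1 ≤ degreeIn 2 (toCounts 2 v) inc ∧
      (v.isOfForm1315 = false → 3 ≤ (v.scalarLegs - inc.intScalar) + (v.vectorLegs - inc.intVector) →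
        2 ≤ degreeIn 2 (toCounts 2 v) inc) ∧
      (v.isOfForm1315 = false → 5 ≤ (v.scalarLegs - inc.intScalar) + (v.vectorLegs - inc.intVector) →
        3 ≤ degreeIn 2 (toCounts 2 v) inc) := by
  obtain ⟨s', a', δ', hs, ha, hδ⟩ := inc
  dsimp only at hδs
  have hδ' : (δ' : ℚ) ≤ _ := Nat.cast_le.mpr hδ
  have ha0 : (0 : ℚ) ≤ a' := Nat.cast_nonneg _
  cases v <;>
    simp only [VertexKind.Admissible, VertexKind.isOfForm1315, toCounts, VertexKind.etaCount, VertexKind.scalarLegs,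
      VertexKind.vectorLegs, VertexKind.diffCount, VertexKind.isAveragingVertex, degreeIn, Nat.cast_ofNat, Nat.cast_zero,
      Nat.cast_one, Bool.false_eq_true, if_false, if_true, nonpos_iff_eq_zero] at hv hδ' hδ hs ha ⊢ <;>
    push_cast at hδ' ⊢
  case v16 => refine ⟨by linarith, fun _ _ => by linarith, fun _ h => by omega⟩
  case v17 => refine ⟨by linarith, fun _ h => by omega, fun _ h => by omega⟩
  case v18 n n' =>
    obtain ⟨-, -, h1⟩ := hv
    have h1' : (1 : ℚ) ≤ n + n' := by exact_mod_cast h1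
    have : (0 : ℚ) ≤ n' := Nat.cast_nonneg _
    refine ⟨by linarith, fun _ h => ?_, fun _ h => ?_⟩
    · rcases Nat.eq_zero_or_pos δ' with h0 | hpos
      · subst h0; simp; linarith
      · have : (2 : ℚ) ≤ n := by exact_mod_cast (show 2 ≤ n by omega)
        linarith
    · rcases Nat.eq_zero_or_pos δ' with h0 | hpos
      · subst h0
        have : (3 : ℚ) ≤ n := by exact_mod_cast (show 3 ≤ n by omega)
        simp; linarith
      · have : (4 : ℚ) ≤ n := by exact_mod_cast (show 4 ≤ n by omega)
        linarith
  case v19 n nb =>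
    have : (0 : ℚ) ≤ nb := Nat.cast_nonneg _
    have : (0 : ℚ) ≤ n := Nat.cast_nonneg _
    refine ⟨by linarith, fun _ h => ?_, fun _ h => ?_⟩
    · have : (1 : ℚ) ≤ n := by exact_mod_cast (show 1 ≤ n by omega)
      linarith
    · have : (3 : ℚ) ≤ n := by exact_mod_cast (show 3 ≤ n by omega)
      linarith
  case v110 n n' =>
    obtain ⟨-, -, -, h2⟩ := hv
    have h2' : (2 : ℚ) ≤ n + n' := by exact_mod_cast h2
    have : (0 : ℚ) ≤ n' := Nat.cast_nonneg _
    refine ⟨by linarith, fun _ _ => by linarith, fun _ h => ?_⟩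
    have : (3 : ℚ) ≤ n := by exact_mod_cast (show 3 ≤ n by omega)
    linarith
  case v111 n nb =>
    have : (0 : ℚ) ≤ nb := Nat.cast_nonneg _
    have : (0 : ℚ) ≤ n := Nat.cast_nonneg _
    refine ⟨by linarith, fun _ h => ?_, fun _ h => ?_⟩
    · have : (1 : ℚ) ≤ n := by exact_mod_cast (show 1 ≤ n by omega)
      linarith
    · have : (3 : ℚ) ≤ n := by exact_mod_cast (show 3 ≤ n by omega)
      linarith
  case v113 => subst hδ; refine ⟨by simp, by simp, by simp⟩
  case v114 n n' => subst hδ; refine ⟨by simp; linarith, by simp, by simp⟩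
  case v115 n nb => subst hδ; refine ⟨by simp; linarith, by simp, by simp⟩

/-- d = 2, vertices (1.13)–(1.15): D_G(v) = 2 + (#internal A′-legs) ≥ 2 = d, and ≥ 3 > d as soon as one A′-leg is internal
(p. 428: *"If it is a vector field line, then we always have D_G(v) − d ≥ 0"*). [cite: Balaban1983Higgs3, p.428] -/
theorem degreeIn_1315 (v : VertexKind) (h1315 : v.isOfForm1315 = true) (inc : Incidence (toCounts 2 v)) :
    2 ≤ degreeIn 2 (toCounts 2 v) inc ∧ (1 ≤ inc.intVector → 3 ≤ degreeIn 2 (toCounts 2 v) inc) := by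
  obtain ⟨s', a', δ', hs, ha, hδ⟩ := inc
  have ha0 : (0 : ℚ) ≤ a' := Nat.cast_nonneg _
  cases v <;>
    simp only [VertexKind.isOfForm1315, toCounts, VertexKind.etaCount, VertexKind.scalarLegs, VertexKind.vectorLegs,
      VertexKind.diffCount, VertexKind.isAveragingVertex, degreeIn, Nat.cast_ofNat,
      Bool.false_eq_true, if_false, if_true, nonpos_iff_eq_zero] at h1315 ha hδ ⊢ <;>
    subst hδ <;> push_cast
  case v113 => subst ha; simp
  case v114 n n' =>
    refine ⟨by linarith, fun h1 => ?_⟩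
    have : (1 : ℚ) ≤ a' := by exact_mod_cast h1
    linarith
  case v115 n nb =>
    refine ⟨by linarith, fun h1 => ?_⟩
    have : (1 : ℚ) ≤ a' := by exact_mod_cast h1
    linarith

/-- d = 2: an admissible R-vertex (1.9)/(1.11) has D_G(v) ≥ n̄ + 1 in every graph. [cite: Balaban1983Higgs3, p.429] -/
theorem nbar_add_one_le_degreeIn {nbar : ℕ} (v : VertexKind) (hR : v.isRVertex = true) (h1315 : v.isOfForm1315 = false)
    (hv : v.Admissible nbar) (inc : Incidence (toCounts 2 v)) : (nbar : ℚ) + 1 ≤ degreeIn 2 (toCounts 2 v) inc := by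
  obtain ⟨s', a', δ', hs, ha, hδ⟩ := inc
  have hδ' : (δ' : ℚ) ≤ _ := Nat.cast_le.mpr hδ
  cases v <;>
    simp only [VertexKind.isRVertex, VertexKind.isOfForm1315, VertexKind.Admissible, toCounts, VertexKind.etaCount,
      VertexKind.scalarLegs, VertexKind.vectorLegs, VertexKind.diffCount, VertexKind.isAveragingVertex, degreeIn,
      Nat.cast_ofNat, Nat.cast_zero, Nat.cast_one, Bool.false_eq_true, if_false, Bool.true_eq_false] at hR h1315 hv hδ' ⊢
  case v19 n nb =>
    obtain ⟨rfl, -⟩ := hv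
    push_cast at hδ' ⊢
    have : (0 : ℚ) ≤ n := Nat.cast_nonneg _
    linarith
  case v111 n nb =>
    obtain ⟨rfl, -⟩ := hv
    push_cast at hδ' ⊢
    have : (0 : ℚ) ≤ n := Nat.cast_nonneg _
    linarith

end Facts

variable {nbar : ℕ} (G : Graph nbar)

/-- kernel: the catalogue vertices carry at most one differentiation ((1.8)/(1.9) one, the others none).
[cite: Balaban1983Higgs3, (1.6)–(1.15) pp.413–414] -/
theorem diffCount_le_one (v : VertexKind) : v.diffCount ≤ 1 := by
  cases v <;> simp [VertexKind.diffCount]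

/-- kernel: a differentiation acting on an internal line acts on an internal φ′-leg, so #(internal differentiations) ≤
#(internal φ′-legs) for every vertex of a graph of the model. [cite: Balaban1983Higgs3, (2.1) p.422] -/
theorem intDiffs_le_intScalar (i : Fin G.nV) : G.intDiffs i ≤ G.intScalar i := by
  unfold Graph.intDiffs
  split_ifs with h hsome
  · exact (diffCount_le_one _).trans (G.one_le_intScalar ⟨0, h⟩ hsome)
  · exact Nat.zero_le _
  · exact Nat.zero_le _

/-- d = 2: every vertex of a graph of the model has D_G(v) ≥ 1. [cite: Balaban1983Higgs3, p.423] -/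
theorem one_le_vertexDeg (i : Fin G.nV) : 1 ≤ G.vertexDeg 2 i :=
  (Facts.one_le_degreeIn (G.kind i) (G.adm i) (G.incidence 2 i) (intDiffs_le_intScalar G i)).1

/-- kernel: two distinct vertex degrees are at most Σ_v D_G(v) (d = 2). [cite: Balaban1983Higgs3, (2.2) p.423] -/
theorem vdeg_pair_le_sum {i j : Fin G.nV} (hij : i ≠ j) : G.vertexDeg 2 i + G.vertexDeg 2 j ≤ ∑ l, G.vertexDeg 2 l :=
  calc G.vertexDeg 2 i + G.vertexDeg 2 j = ∑ l ∈ ({i, j} : Finset (Fin G.nV)), G.vertexDeg 2 l := (sum_pair hij).symm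
    _ ≤ ∑ l, G.vertexDeg 2 l :=
      sum_le_sum_of_subset_of_nonneg (subset_univ _) fun l _ _ => (one_le_vertexDeg G l).trans' (by norm_num)

/-- kernel: in d = 2, D(G) > 0 iff Σ_v D_G(v) > 2. [cite: Balaban1983Higgs3, (2.2) p.423] -/
theorem deg_pos_iff : 0 < G.deg 2 ↔ 2 < ∑ l, G.vertexDeg 2 l := by
  rw [G.deg_eq]; push_cast; constructor <;> intro h <;> linarith

/-- kernel: a graph of the model has another vertex besides `i`, or one of the legs of `i` lies on an internal line (the line of
p. 415 *"There is at least one internal line"*). [cite: Balaban1983Higgs3, p.415] -/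
theorem exists_ne_or_internal (i : Fin G.nV) : (∃ i', i' ≠ i) ∨ 1 ≤ G.intScalar i ∨ 1 ≤ G.intVector i := by
  obtain ⟨⟨i₀, y₀⟩, h₀⟩ := G.exists_line
  by_cases hne : i₀ = i
  · subst hne
    cases y₀ with
    | inl j => exact Or.inr (Or.inl (G.one_le_intScalar j h₀))
    | inr j => exact Or.inr (Or.inr (G.one_le_intVector j h₀))
  · exact Or.inl ⟨i₀, hne⟩

/-- Cor. 2.3, first clause, d = 2 (*"In d = 2 graphs are more convergent, so degrees are still positive"*, p. 429): a vertex of the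
form (1.13)–(1.15) ⇒ D(G) > 0, for every graph of the model. [cite: Balaban1983Higgs3, Cor. 2.3 p.429] -/
theorem deg_pos_of_hasVertex1315 (h : G.HasVertex1315) : 0 < G.deg 2 := by
  obtain ⟨i, hi⟩ := h
  obtain ⟨h2, h3⟩ := Facts.degreeIn_1315 (G.kind i) hi (G.incidence 2 i)
  change 2 ≤ G.vertexDeg 2 i at h2
  change 1 ≤ G.intVector i → 3 ≤ G.vertexDeg 2 i at h3
  rw [deg_pos_iff]
  rcases exists_ne_or_internal G i with ⟨i', hne⟩ | hsc | hvec
  · linarith [one_le_vertexDeg G i', vdeg_pair_le_sum G hne.symm]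
  · -- the internal φ′-leg of v ends at another vertex (v has a single φ′-leg)
    obtain ⟨j, hj⟩ := G.exists_of_one_le_intScalar hsc
    obtain ⟨y, hy⟩ := Option.isSome_iff_exists.mp hj
    obtain ⟨i', j', rfl, hy'⟩ := G.other_scalar hy
    have hne : i' ≠ i := by
      rintro rfl
      have h1 := B3Cor23Concrete.Facts.scalarLegs_of_isOfForm1315 _ hi
      have hjj : j' = j := Fin.ext (by have := j.isLt; have := j'.isLt; omega)
      subst hjj
      exact G.other_ne _ _ hy rfl
    linarith [one_le_vertexDeg G i', vdeg_pair_le_sum G hne.symm]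
  · linarith [h3 hvec, Finset.single_le_sum (fun l _ => (one_le_vertexDeg G l).trans' (by norm_num)) (mem_univ i)]

/-- Cor. 2.3, second clause, d = 2: an R-vertex ⇒ D(G) > 0, for every graph of the model and every n̄ ≥ 3 (print: n̄ > 12).
[cite: Balaban1983Higgs3, Cor. 2.3 p.429] -/
theorem deg_pos_of_hasRVertex (hn : 3 ≤ nbar) (h : G.HasRVertex) : 0 < G.deg 2 := by
  obtain ⟨i, hi⟩ := h
  by_cases h1315 : (G.kind i).isOfForm1315 = true
  · exact deg_pos_of_hasVertex1315 G ⟨i, h1315⟩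
  rw [deg_pos_iff]
  have hR := Facts.nbar_add_one_le_degreeIn (G.kind i) hi (by simpa using h1315) (G.adm i) (G.incidence 2 i)
  change (nbar : ℚ) + 1 ≤ G.vertexDeg 2 i at hR
  have : (3 : ℚ) ≤ nbar := by exact_mod_cast hn
  linarith [Finset.single_le_sum (fun l _ => (one_le_vertexDeg G l).trans' (by norm_num)) (mem_univ i)]

/-- Cor. 2.3, fourth clause, d = 2: more than four external legs ⇒ D(G) > 0, for every graph of the model ((2.17) gives D(G) ≥
V − 2 in d = 2; graphs with ≤ 2 vertices and ≥ 5 external legs have a vertex with ≥ 3 external legs, of degree ≥ 2, resp. ≥ 3).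
[cite: Balaban1983Higgs3, Cor. 2.3 p.429] -/
theorem deg_pos_of_four_lt_numExtLegs (h : 4 < G.numExtLegs) : 0 < G.deg 2 := by
  by_cases h1315 : G.HasVertex1315
  · exact deg_pos_of_hasVertex1315 G h1315
  rw [deg_pos_iff]
  have hnot : ∀ i, (G.kind i).isOfForm1315 = false := fun i => by
    by_contra hc; exact h1315 ⟨i, by simpa using hc⟩
  have hfacts := fun i => Facts.one_le_degreeIn (G.kind i) (G.adm i) (G.incidence 2 i) (intDiffs_le_intScalar G i)
  by_cases hbig : ∃ i₀, 3 ≤ G.extLegs i₀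
  · obtain ⟨i₀, hi₀⟩ := hbig
    have h2 : 2 ≤ G.vertexDeg 2 i₀ := (hfacts i₀).2.1 (hnot i₀) hi₀
    by_cases hex : ∃ i₁, i₁ ≠ i₀
    · obtain ⟨i₁, hne⟩ := hex
      linarith [one_le_vertexDeg G i₁, vdeg_pair_le_sum G hne.symm]
    · push Not at hex
      have huniv : (univ : Finset (Fin G.nV)) = {i₀} := by ext i; simp [hex i]
      have hE : G.numExtLegs = G.extLegs i₀ := by simp [Graph.numExtLegs, huniv]
      have h3 : 3 ≤ G.vertexDeg 2 i₀ := (hfacts i₀).2.2 (hnot i₀) (by change 5 ≤ G.extLegs i₀; omega)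
      have : ∑ l, G.vertexDeg 2 l = G.vertexDeg 2 i₀ := by rw [huniv, sum_singleton]
      linarith
  · push Not at hbig
    have hle : G.numExtLegs ≤ G.nV * 2 := by
      unfold Graph.numExtLegs
      have := sum_le_card_nsmul univ G.extLegs 2 fun i _ => by have := hbig i; omega
      simpa using this
    have hV : (3 : ℚ) ≤ G.nV := by exact_mod_cast (show 3 ≤ G.nV by omega)
    have hsd : (G.nV : ℚ) * 1 ≤ ∑ l, G.vertexDeg 2 l := by
      have := card_nsmul_le_sum univ (fun l => G.vertexDeg 2 l) 1 fun l _ => one_le_vertexDeg G l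
      simpa using this
    linarith

/-- Cor. 2.3, third clause repaired, d = 2: a vertex (1.7) with finite counterterms AND at least two external legs ⇒ D(G) > 0
(the (1.7)-tadpole has D = 0 in d = 2, `B3Cor23ConcreteProof.tadpole17_deg`). [cite: Balaban1983Higgs3, Cor. 2.3 p.429] -/
theorem deg_pos_of_hasFiniteCounterterm (h : G.HasFiniteCounterterm) (hE : 2 ≤ G.numExtLegs) : 0 < G.deg 2 := by
  obtain ⟨i₀, hi₀⟩ := h
  rw [deg_pos_iff]
  have hd₀ : G.vertexDeg 2 i₀ = 2 := by
    rw [Graph.vertexDeg_eq]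
    have := G.intDiffs_le i₀
    simp only [hi₀, VertexKind.diffCount, nonpos_iff_eq_zero] at this
    simp [hi₀, VertexKind.etaCount, VertexKind.isAveragingVertex, this]
  by_cases hex : ∃ i₁, i₁ ≠ i₀
  · obtain ⟨i₁, hne⟩ := hex
    linarith [one_le_vertexDeg G i₁, vdeg_pair_le_sum G hne.symm]
  · exfalso
    push Not at hex
    have huniv : (univ : Finset (Fin G.nV)) = {i₀} := by ext i; simp [hex i]
    have hEeq : G.numExtLegs = G.extLegs i₀ := by simp [Graph.numExtLegs, huniv]
    have hvl : G.intVector i₀ ≤ 0 := by simpa [hi₀, VertexKind.vectorLegs] using G.intVector_le i₀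
    have hext : G.extLegs i₀ = 2 - G.intScalar i₀ := by simp [Graph.extLegs, hi₀, VertexKind.scalarLegs, VertexKind.vectorLegs]
    obtain ⟨⟨i', y⟩, hy⟩ := G.exists_line
    obtain rfl := hex i'
    cases y with
    | inl j => have := G.one_le_intScalar j hy; omega
    | inr j => have := G.one_le_intVector j hy; omega

/-- **Corollary 2.3** with the repaired third clause, d = 2, every graph of the model, n̄ ≥ 3. [cite: Balaban1983Higgs3, Cor. 2.3 p.429] -/
theorem cor23_corrected (hn : 3 ≤ nbar)
    (h : G.HasVertex1315 ∨ G.HasRVertex ∨ (G.HasFiniteCounterterm ∧ 2 ≤ G.numExtLegs) ∨ 4 < G.numExtLegs) : 0 < G.deg 2 := by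
  rcases h with h | h | ⟨h, hE⟩ | h
  · exact deg_pos_of_hasVertex1315 G h
  · exact deg_pos_of_hasRVertex G hn h
  · exact deg_pos_of_hasFiniteCounterterm G h hE
  · exact deg_pos_of_four_lt_numExtLegs G h

/-- **Corollary 2.3** p. 429 verbatim (`B3Sect2Statements.Cor23`), d = 2 (*"In d = 2 graphs are more convergent, so degrees are
still positive"*), PROVED for the concrete family of graphs with at least two external legs, every n̄ ≥ 3; it fails on the whole
family (`B3Cor23ConcreteProof.not_cor23 2`). [cite: Balaban1983Higgs3, Cor. 2.3 p.429] -/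
theorem cor23_twoExtLegs (nbar : ℕ) (hn : 3 ≤ nbar) : Cor23 (familyTwoExtLegs 2 nbar) := by
  rintro ⟨G, hE⟩ h
  change G.HasVertex1315 ∨ G.HasRVertex ∨ G.HasFiniteCounterterm ∨ 4 < G.numExtLegs at h
  change 0 < G.deg 2
  rcases h with h | h | h | h
  · exact deg_pos_of_hasVertex1315 G h
  · exact deg_pos_of_hasRVertex G hn h
  · exact deg_pos_of_hasFiniteCounterterm G h hE
  · exact deg_pos_of_four_lt_numExtLegs G h

end Literature.MathematicalPhysics.QuantumFieldTheory.Balaban1983to89.B3Cor23ConcreteTwoDim
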